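import Summits.QuantumFields.YangMills.Theorems.F4SubCurvatureDoorShortRootRigidityPlanarNarrowTube
import Summits.QuantumFields.YangMills.Theorems.F4SubCurvatureDoorAngularContinuationCharts
import Mathlib
import HarnessLib

/-!
# Registered stub «CONE PACKAGING» of LINE g21-C «aperture bootstrap» (crux ⟨stmt-QuantumFields-23035⟩
# `F4SubCurvatureDoor.ShortRootRigidity`), BY NAME AND SIGNATURE

Skeleton `Cruxes/ShortRootRigidity/Lines/aperture_bootstrap.lean` (ideator ym-idea-3 g21; critic idea-crit-4 PASS A−), stub :141
`stub_planarSpectralCone_of_coneSupport : PlanarConeSupport → ∀ k : E2 → ℝ, InPlanarClass k → PlanarSpectralCone k` (S–M).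
Free-hands work of width seat `ym-line-sfw-p2-w3` (g38, cell `ym-idea-1`).

The registered texts `IsPlanarLF` (:77), `HasAperture` (:83), `PlanarConeSupport` (:110) are restated CHARACTER-FOR-CHARACTER below and
`PlanarSpectralCone` is, as in the skeleton (:114), the `abbrev` of the landed chart text `AngularType.PlanarSpectralConeFrame`
(`Theorems/F4SubCurvatureDoorAngularContinuationCharts`); `mk2`, `fwdTube` are the chart file's, `InPlanarClass` the slice file's.

PROOF (the proof of `…PlanarNarrowTube.planarNarrowTube` ✓ with the exponential-moment domination replaced by the SUPPORT condition):
for `k ∈ InPlanarClass` take a Laplace–Fourier representing measure `μ` of the frame (`exists_planarLF` ✓); `PlanarConeSupport` gives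
`HasAperture μ 1`, i.e. `|p| ≤ E` `μ`-a.e.; for `ε > 0` the function `F(ζ, β) = ∫ e^{−(ε+ζ)E} cos(βp) dμ(E, p)` is holomorphic on the
forward tube `{|Im β| < Re ζ}` (dominated holomorphic parameter integral, `Literature.Analysis.Complex.differentiableOn_integral_of_dominated`,
local dominator `2e^{−(ε+2R)E}` with margin `4R = Re ζ₀ − |Im β₀|`), has real points `F(t, b) = k(ε + t, b)` and obeys the cone majorant
`‖F(ζ, β)‖ ≤ ∫ e^{−(ε + Re ζ − |Im β|)E} dμ = k(ε + Re ζ − |Im β|, 0)`.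

HONEST LABEL: one S–M registered stub of an OPEN line; the STEP (:137), `FlatDoubleEdge` (:128), `PlanarInitialAperture` (:132),
`OddModeRigidity` (:146), (C), ⟨23035⟩, ⟨23125⟩, R2d and the Yang–Mills mass gap remain OPEN; no summit is proved by a line.
-/

noncomputable section

namespace Summit.QuantumFields.YangMills.Theorems.F4SubCurvatureDoorConePackagingRegistered

open MeasureTheory Filter Topology Set Metric Complex
open scoped BigOperators NNReal ENNReal
open Summit.QuantumFields.YangMills.Theorems.F4SubCurvatureDoorSliceDensityRegistered (E2)
open Summit.QuantumFields.YangMills.Theorems.F4SubCurvatureDoorSliceInClassRegistered (InPlanarClass)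
open Summit.QuantumFields.YangMills.Theorems.F4SubCurvatureDoorPlanarLaplaceFourier (exists_planarLF ae_energy_nonneg)
open Summit.QuantumFields.YangMills.Theorems.F4SubCurvatureDoorPlanarNarrowTube (norm_cos_le norm_kernel_le)
open Summit.QuantumFields.YangMills.Cruxes.ShortRootRigidity.AngularType (mk2 fwdTube PlanarSpectralConeFrame)

/-! ## The registered texts (verbatim from the skeleton `Lines/aperture_bootstrap.lean`) -/

/-- A planar Laplace–Fourier representing measure of the frame-`0` transform of `k` (the binder shape of the landed
`planarExponentialMoments` / `planarNarrowTube` / `exists_planarLF`, named). [problem-side vocabulary] -/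
def IsPlanarLF (k : E2 → ℝ) (μ : Measure (ℝ × ℝ)) : Prop :=
  μ (Set.Iio 0 ×ˢ Set.univ) = 0 ∧
    ∀ t : ℝ, 0 < t → Integrable (fun z : ℝ × ℝ => Real.exp (-(t * z.1))) μ ∧
      ∀ x : ℝ, k (mk2 t x) = ∫ z, Real.exp (-(z.1 * t)) * Real.cos (z.2 * x) ∂μ

/-- Aperture `τ` in SUPPORT form: no Laplace–Fourier mass strictly below the cone of slope `τ`. [problem-side vocabulary] -/
def HasAperture (μ : Measure (ℝ × ℝ)) (τ : ℝ) : Prop :=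
  μ {z : ℝ × ℝ | z.1 < τ * |z.2|} = 0

/-- «PLANAR CONE SUPPORT» (the support form of (C)). [problem-side definition] -/
def PlanarConeSupport : Prop :=
  ∀ (k : E2 → ℝ) (μ : Measure (ℝ × ℝ)), InPlanarClass k → IsPlanarLF k μ → HasAperture μ 1

/-- (C) of LINE g20-A, verbatim (the landed chart file stores the text as `PlanarSpectralConeFrame`; this is the same constant). -/
abbrev PlanarSpectralCone (k : E2 → ℝ) : Prop := PlanarSpectralConeFrame k

/-! ## Bookkeeping -/

/-- `mk2` is the `WithLp` constructor of the chart files. -/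
theorem mk2_def (a b : ℝ) : mk2 a b = (WithLp.equiv 2 (Fin 2 → ℝ)).symm ![a, b] := rfl

/-- Under aperture `1` the Laplace–Fourier measure is carried by `{|p| ≤ E}`. -/
theorem ae_abs_le_of_hasAperture_one {μ : Measure (ℝ × ℝ)} (h : HasAperture μ 1) : ∀ᵐ z ∂μ, |z.2| ≤ z.1 := by
  rw [ae_iff]
  have : {z : ℝ × ℝ | ¬ |z.2| ≤ z.1} = {z : ℝ × ℝ | z.1 < 1 * |z.2|} := by
    ext z; simp [not_le]
  rw [this]
  exact h

/-- The pointwise cone majorant of the kernel: for `|p| ≤ E`: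
`‖e^{−(ε+ζ)E} cos(βp)‖ ≤ e^{−(ε + Re ζ − |Im β|)E}`. -/
theorem norm_kernel_le_cone {ζ β : ℂ} {ε E p : ℝ} (hp : |p| ≤ E) :
    ‖Complex.exp (-(((ε : ℂ) + ζ) * (E : ℂ))) * Complex.cos (β * (p : ℂ))‖
      ≤ Real.exp (-((ε + (ζ.re - |β.im|)) * E)) := by
  rw [norm_mul, Complex.norm_exp]
  have hre : (-(((ε : ℂ) + ζ) * (E : ℂ))).re = -((ε + ζ.re) * E) := by
    simp [Complex.mul_re]
  rw [hre]
  have him : (β * (p : ℂ)).im = β.im * p := by simp [Complex.mul_im]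
  have hcos := norm_cos_le (β * (p : ℂ))
  rw [him] at hcos
  have h1 : Real.exp (β.im * p) ≤ Real.exp (|β.im| * E) := Real.exp_le_exp.2 (by
    calc β.im * p ≤ |β.im * p| := le_abs_self _
      _ = |β.im| * |p| := abs_mul _ _
      _ ≤ |β.im| * E := mul_le_mul_of_nonneg_left hp (abs_nonneg _))
  have h2 : Real.exp (-(β.im * p)) ≤ Real.exp (|β.im| * E) := Real.exp_le_exp.2 (by
    calc -(β.im * p) ≤ |β.im * p| := neg_le_abs _
      _ = |β.im| * |p| := abs_mul _ _
      _ ≤ |β.im| * E := mul_le_mul_of_nonneg_left hp (abs_nonneg _))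
  have hc : ‖Complex.cos (β * (p : ℂ))‖ ≤ Real.exp (|β.im| * E) := hcos.trans (by linarith)
  calc Real.exp (-((ε + ζ.re) * E)) * ‖Complex.cos (β * (p : ℂ))‖
      ≤ Real.exp (-((ε + ζ.re) * E)) * Real.exp (|β.im| * E) :=
        mul_le_mul_of_nonneg_left hc (Real.exp_pos _).le
    _ = Real.exp (-((ε + (ζ.re - |β.im|)) * E)) := by rw [← Real.exp_add]; ring_nf

/-! ## The stub -/

/-- **Registered stub «CONE PACKAGING», BY NAME AND SIGNATURE**: the support form of the planar spectral cone (every Laplace–Fourier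
representing measure of the frame is carried by the forward light cone `{E ≥ |p|}`) yields the registered tube form (C) = `PlanarSpectralCone`
for every kernel of the planar class. [folklore] -/
theorem stub_planarSpectralCone_of_coneSupport :
    PlanarConeSupport → ∀ k : E2 → ℝ, InPlanarClass k → PlanarSpectralCone k := by
  intro hsupp k hk ε hε
  obtain ⟨μ, hμ0, hμ⟩ := exists_planarLF k hk
  have hLF : IsPlanarLF k μ := ⟨hμ0, fun t ht => ⟨(hμ t ht).1, fun x => by rw [mk2_def]; exact (hμ t ht).2 x⟩⟩
  have hap : HasAperture μ 1 := hsupp k μ hk hLF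
  have hae0 : ∀ᵐ z ∂μ, 0 ≤ z.1 := ae_energy_nonneg hμ0
  have haeC : ∀ᵐ z ∂μ, |z.2| ≤ z.1 := ae_abs_le_of_hasAperture_one hap
  -- the kernel and its regularity
  have hKc : ∀ q : ℂ × ℂ, Continuous fun z : ℝ × ℝ =>
      Complex.exp (-(((ε : ℂ) + q.1) * (z.1 : ℂ))) * Complex.cos (q.2 * (z.2 : ℂ)) := fun q => by fun_prop
  have hKd : ∀ z : ℝ × ℝ, Differentiable ℂ fun q : ℂ × ℂ =>
      Complex.exp (-(((ε : ℂ) + q.1) * (z.1 : ℂ))) * Complex.cos (q.2 * (z.2 : ℂ)) := fun z => by fun_prop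
  -- representation at real points, in the complex form
  have hrepr : ∀ s b : ℝ, 0 < s →
      (∫ z : ℝ × ℝ, Complex.exp (-((s : ℂ) * (z.1 : ℂ))) * Complex.cos ((b : ℂ) * (z.2 : ℂ)) ∂μ) = ((k (mk2 s b) : ℝ) : ℂ) := by
    intro s b hs
    rw [mk2_def, (hμ s hs).2 b, ← integral_complex_ofReal]
    refine integral_congr_ae (Eventually.of_forall fun z => ?_)
    dsimp only
    rw [show -((s : ℂ) * (z.1 : ℂ)) = ((-(z.1 * s) : ℝ) : ℂ) by push_cast; ring,
      show (b : ℂ) * (z.2 : ℂ) = ((z.2 * b : ℝ) : ℂ) by push_cast; ring,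
      ← Complex.ofReal_exp, ← Complex.ofReal_cos]
    push_cast; ring
  refine ⟨fun q => ∫ z : ℝ × ℝ, Complex.exp (-(((ε : ℂ) + q.1) * (z.1 : ℂ))) * Complex.cos (q.2 * (z.2 : ℂ)) ∂μ, ?_, ?_, ?_⟩
  · -- holomorphy on the forward tube
    refine Literature.Analysis.Complex.differentiableOn_integral_of_dominated (fun q _ => (hKc q).aestronglyMeasurable)
      (Eventually.of_forall fun z => (hKd z).differentiableOn) ?_
    intro q₀ hq₀
    have hq₀' : |q₀.2.im| < q₀.1.re := hq₀
    set R : ℝ := (q₀.1.re - |q₀.2.im|) / 4 with hR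
    have hRpos : 0 < R := by rw [hR]; linarith
    have hbasic : ∀ q : ℂ × ℂ, q ∈ ball q₀ R → q₀.1.re - R < q.1.re ∧ |q.2.im| < |q₀.2.im| + R := by
      intro q hq
      rw [mem_ball, Prod.dist_eq, max_lt_iff] at hq
      have h1 : |q.1.re - q₀.1.re| < R := lt_of_le_of_lt (by
        simpa using Complex.abs_re_le_norm (q.1 - q₀.1)) (by rw [← dist_eq_norm]; exact hq.1)
      have h2 : |q.2.im - q₀.2.im| < R := lt_of_le_of_lt (by
        simpa using Complex.abs_im_le_norm (q.2 - q₀.2)) (by rw [← dist_eq_norm]; exact hq.2)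
      rw [abs_lt] at h1
      have h3 := abs_add_le (q.2.im - q₀.2.im) q₀.2.im
      rw [sub_add_cancel] at h3
      exact ⟨by linarith, by linarith⟩
    have hInt := (hμ (ε + 2 * R) (by linarith)).1
    refine ⟨R, hRpos, ?_, fun z => Real.exp (-((ε + 2 * R) * z.1)) + Real.exp (-((ε + 2 * R) * z.1)), hInt.add hInt, ?_⟩
    · -- the ball stays in the tube
      intro q hq
      obtain ⟨h1, h2⟩ := hbasic q hq
      show |q.2.im| < q.1.re
      linarith
    · -- domination
      filter_upwards [hae0, haeC] with z hz hzC q hq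
      obtain ⟨h1, h2⟩ := hbasic q hq
      have hζ : ε + (q₀.1.re - R) ≤ (((ε : ℂ) + q.1)).re := by
        simp only [Complex.add_re, Complex.ofReal_re]; linarith
      have hσ : |q.2.im| ≤ |q₀.2.im| + R := h2.le
      refine (norm_kernel_le hz hζ hσ).trans ?_
      have hp1 : (|q₀.2.im| + R) * z.2 ≤ (|q₀.2.im| + R) * z.1 := by
        have : z.2 ≤ z.1 := (le_abs_self _).trans hzC
        exact mul_le_mul_of_nonneg_left this (by positivity)
      have hp2 : -(|q₀.2.im| + R) * z.2 ≤ (|q₀.2.im| + R) * z.1 := by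
        have : -z.2 ≤ z.1 := (neg_le_abs _).trans hzC
        nlinarith [abs_nonneg q₀.2.im]
      have hsum : ε + (q₀.1.re - R) - (|q₀.2.im| + R) = ε + 2 * R := by rw [hR]; ring
      refine add_le_add (Real.exp_le_exp.2 ?_) (Real.exp_le_exp.2 ?_)
      · nlinarith
      · nlinarith
  · -- real points
    intro t b ht
    have h := hrepr (ε + t) b (by linarith)
    push_cast at h
    simpa using h
  · -- the cone majorant
    intro w hw
    have hw' : |w.2.im| < w.1.re := hw
    have hs : 0 < ε + (w.1.re - |w.2.im|) := by linarith
    have hInt := (hμ (ε + (w.1.re - |w.2.im|)) hs).1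
    have hbound : ∀ᵐ z ∂μ, ‖Complex.exp (-(((ε : ℂ) + w.1) * (z.1 : ℂ))) * Complex.cos (w.2 * (z.2 : ℂ))‖
        ≤ Real.exp (-((ε + (w.1.re - |w.2.im|)) * z.1)) := by
      filter_upwards [haeC] with z hzC
      exact norm_kernel_le_cone hzC
    refine (norm_integral_le_of_norm_le hInt hbound).trans (le_of_eq ?_)
    -- `∫ e^{-sE} dμ = k (mk2 s 0)`
    have h := hrepr (ε + (w.1.re - |w.2.im|)) 0 hs
    have h' : (∫ z : ℝ × ℝ, Complex.exp (-(((ε + (w.1.re - |w.2.im|) : ℝ) : ℂ) * (z.1 : ℂ))) * Complex.cos (((0 : ℝ) : ℂ) * (z.2 : ℂ)) ∂μ)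
        = ∫ z : ℝ × ℝ, ((Real.exp (-((ε + (w.1.re - |w.2.im|)) * z.1)) : ℝ) : ℂ) ∂μ := by
      refine integral_congr_ae (Eventually.of_forall fun z => ?_)
      dsimp only
      rw [Complex.ofReal_zero, zero_mul, Complex.cos_zero, mul_one,
        show -(((ε + (w.1.re - |w.2.im|) : ℝ) : ℂ) * (z.1 : ℂ)) = ((-((ε + (w.1.re - |w.2.im|)) * z.1) : ℝ) : ℂ) by push_cast; ring,
        ← Complex.ofReal_exp]
    rw [h', integral_complex_ofReal] at h
    exact_mod_cast h

end Summit.QuantumFields.YangMills.Theorems.F4SubCurvatureDoorConePackagingRegistered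

end
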